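import Literature.MathematicalPhysics.QuantumFieldTheory.Balaban1983to89.B9Thm31GpMajFromPinsPairM
import Literature.MathematicalPhysics.QuantumFieldTheory.Balaban1983to89.B9BackgroundsKLevelV1R

/-!
# `Balaban1983to89.B9Thm31GpMajFromPinsPairMR` — CASCADE-R STEP 3: THE R-GENERIC TWINS of dag-n06-l's Theorem-3.1 letter face `thm31GpMaj_of_t37_pairM` ∕
# `thm31GpMaj_of_thm37Printed` (rows 20–21's `h31` derived from rows 18's leaf), re-typed over the CLASS-PARAMETRIC member background `bg9YR 𝔸 G R₁ R₂`

T. Bałaban, *Propagators for lattice gauge theories in a background field*, Commun. Math. Phys. **99** (1985) 389–434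
[`Balaban1985BackgroundPropagators`, "B9"]; [4] = T. Bałaban, *Propagators and renormalization transformations for lattice gauge
theories. II*, Commun. Math. Phys. **96** (1984) 223–250 [`Balaban1984PropagatorsII`].

statement-level skeleton of published theorems with citation tags; proofs where landed; nothing here is a claim about the
Yang–Mills mass gap

THE PRINTED LOCI.  [B9] Thm 3.7 p. 409 + «Theorem 3.7 implies (3.42)–(3.47)» p. 410; Thm 3.1 (3.42) p. 397; (3.35)–(3.38) p. 396 (the classes of backgrounds — here a
PARAMETER `R₁ x`, `R₂ x` of the member carrier, `B9BackgroundsKLevelV1R.bg9YR`).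

WHY THIS FILE (cell `pub-ymgap`, node N06, seat dag-n06-l g20; dag-n06-d g12's STEP-3 FACE CENSUS I.39391 lists `thm31GpMaj_of_t37_pairM` [n06-l] among the «`bg9Y`-PINNED ✗,
c-GENERIC» faces whose R-twin is «object re-typing»; node00-def-Y g23 RULING-2 (α1) confirmed the R-generic road).  The landed face (`B9Thm31GpMajFromPinsPairM`, p594672) reads
the regularity class of `U` ONLY through Theorem 3.7's printed member clause (it hands `hU` to `t37`), never through the content of (3.35); so its statement re-types verbatim
over `bg9YR 𝔸 G R₁ R₂` — at `R₁ := regY335`, `R₂ := regY336` it is the landed face by `rfl` (`bg9Y_eq_bg9YR`).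
* ★ `thm31GpMaj_of_thm37PrintedR` — the family form under Theorem 3.7's printed prefix at `bg9YR 𝔸 G R₁ R₂`;
* ★★ `thm31GpMaj_of_t37_pairMR` — the `PairM` E-letter specialisation (rows 18's leaf of record, ED.35∕38∕39's `t37`).
HONEST SCOPE.  Mechanical re-typing of two landed one-line wrappers over a background PARAMETER; `Thm37Printed` (rows 18) stays a HYPOTHESIS; nothing of [B9]'s estimates
asserted; COUNT-NEUTRAL; N06 NOT discharged; nothing continuum, nothing about the mass gap.  Cell `pub-ymgap` (HUMAN RULING D-0062), Track A node N06 [B9], seat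
`pub-ymgap-dag-n06-l` (g20), 2026-08-28.
-/

noncomputable section

namespace Literature.MathematicalPhysics.QuantumFieldTheory.Balaban1983to89.B9Thm31GpMajFromPinsPairMR

open B9Thm37Whole (Ops Conv342)
open B9Cor38Whole (WalkReading)
open B9CoReadingCoords (XBK blkBK)
open B9CoReadingCoordsS (XSK blkSK sIK GcoS DcoS DscoS)
open B9PinMembersKLevelV1 (MemberY geo9Y bg9Y)
open B9BackgroundsKLevelV1R (RegFamY bg9YR)
open B9RWSumsDefinitePins (PinPrims)
open B9RWSumsDefinitePinsPair (PairPrims)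
open B9RWSumsDefinitePinsPairM (MixedPrims E37YPairM)
open B9RWSums347DefiniteFaces (exp261)
open B9PerturbationMajorantAlgebra (Thm31GpMaj)
open B9Thm31GpMajFromPinsPairM (thm31GpMaj_of_conv342)
open Node00 (SiteY FBondY IBondY CfgY SiteOpY CovLettersY)
open Node00.OpsYSectDCoords (DvcoKH DvscoKH)

variable {d ℓ : ℕ} {hd : 1 ≤ d + 1} {hL : Odd (ℓ + 1) ∧ 1 < ℓ + 1} {b₀ b₁ : ℝ} {Mstar : ℕ}

section Family

variable {𝔸 : Type} [NormedRing 𝔸] [NormedAlgebra ℂ 𝔸] [CompleteSpace 𝔸] [FiniteDimensional ℝ 𝔸]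
variable {κ : Type} [Fintype κ]
variable [∀ x : MemberY d ℓ hd hL b₀ b₁ Mstar, Fintype (geo9Y x).Site]

/-- ★ **THE FAMILY FORM UNDER THEOREM 3.7's PRINTED PREFIX, R-GENERIC**: for ANY leaf family `E` satisfying `B9.Thm37Printed c35 geo9Y (bg9YR 𝔸 G R₁ R₂) E` whose convergence
predicate projects to `Conv342 (𝔬 x) (R x) (H x) C δ` (`0 ≤ C`), the site pins and a direction-blind `bI`, EVERY member above the leaf's threshold (`M₂ ≤ M`, `0 < α₀`, `Mα₀ ≤ a₀`,
`R₁ x c35 α₀ U`) has `Thm31GpMaj (blkSK (sIK bI)) (blkBK bI) (GcoS … (𝔏 x).Gp U) (DvcoKH … U) (DvscoKH … U) (R x) (H x) ((d+1)C) δ` — the twin of `thm31GpMaj_of_thm37Printed` with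
`bg9Y ↦ bg9YR 𝔸 G R₁ R₂` (the class of `U` is read only through `t37`'s member clause). [cite: Balaban1985BackgroundPropagators, Thm 3.7 p.409 + «Theorem 3.7 implies (3.42)–(3.47)» p.410; Thm 3.1 (3.42) p.397; (3.35)–(3.38) p.396] -/
theorem thm31GpMaj_of_thm37PrintedR {G : Subgroup 𝔸ˣ} {R₁ R₂ : RegFamY d ℓ hd hL b₀ b₁ Mstar 𝔸} (b : Module.Basis κ ℝ 𝔸) {c35 : ℝ}
    (𝔏 : ∀ x : MemberY d ℓ hd hL b₀ b₁ Mstar, CovLettersY 𝔸 x) {ι : MemberY d ℓ hd hL b₀ b₁ Mstar → Type}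
    (𝔬 : ∀ x : MemberY d ℓ hd hL b₀ b₁ Mstar, Ops (geo9Y x) (bg9YR 𝔸 G R₁ R₂ x) (XSK κ x.toKIdx) (XSK κ x.toKIdx) (ι x))
    (E : ∀ x : MemberY d ℓ hd hL b₀ b₁ Mstar, B9.RWExpansion (geo9Y x) (bg9YR 𝔸 G R₁ R₂ x))
    (t37 : B9.Thm37Printed c35 (fun x : MemberY d ℓ hd hL b₀ b₁ Mstar => geo9Y x) (fun x => bg9YR 𝔸 G R₁ R₂ x) E)
    {R : MemberY d ℓ hd hL b₀ b₁ Mstar → ℝ} {H : MemberY d ℓ hd hL b₀ b₁ Mstar → Prop} {C δ : ℝ} (hC : 0 ≤ C)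
    (hconv : ∀ (x : MemberY d ℓ hd hL b₀ b₁ Mstar) (U : (bg9YR 𝔸 G R₁ R₂ x).Cfg), (E x).Converges U → Conv342 (𝔬 x) (R x) (H x) C δ U)
    {bI : ∀ x : MemberY d ℓ hd hL b₀ b₁ Mstar, FBondY x.toKIdx → IBondY x.toKIdx}
    (hbI0 : ∀ (x : MemberY d ℓ hd hL b₀ b₁ Mstar) (f : FBondY x.toKIdx), bI x f = bI x ⟨f.src, 0⟩)
    (hblkS : ∀ x : MemberY d ℓ hd hL b₀ b₁ Mstar, (𝔬 x).blk = blkSK x.toKIdx (sIK x.toKIdx (bI x)))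
    (hblkYS : ∀ x : MemberY d ℓ hd hL b₀ b₁ Mstar, (𝔬 x).blkY = blkSK x.toKIdx (sIK x.toKIdx (bI x)))
    (hGpS : ∀ (x : MemberY d ℓ hd hL b₀ b₁ Mstar) (U : (bg9YR 𝔸 G R₁ R₂ x).Cfg),
      (𝔬 x).Gp U = GcoS x.toKIdx b (bg9YR 𝔸 G R₁ R₂ x) (fun U => U) (𝔏 x).Gp U)
    (hDS : ∀ (x : MemberY d ℓ hd hL b₀ b₁ Mstar) (U : (bg9YR 𝔸 G R₁ R₂ x).Cfg), (𝔬 x).D U = DcoS x.toKIdx b (bg9YR 𝔸 G R₁ R₂ x) (fun U => U) U)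
    (hDsS : ∀ (x : MemberY d ℓ hd hL b₀ b₁ Mstar) (U : (bg9YR 𝔸 G R₁ R₂ x).Cfg), (𝔬 x).Dstar U = DscoS x.toKIdx b (bg9YR 𝔸 G R₁ R₂ x) (fun U => U) U) :
    ∃ M₂ a₀ : ℝ, 0 < M₂ ∧ 0 < a₀ ∧
      ∀ x : MemberY d ℓ hd hL b₀ b₁ Mstar, M₂ ≤ (geo9Y x).M → ∀ α₀ : ℝ, 0 < α₀ → (geo9Y x).M * α₀ ≤ a₀ →
        ∀ U : (bg9YR 𝔸 G R₁ R₂ x).Cfg, (bg9YR 𝔸 G R₁ R₂ x).Reg335 c35 α₀ U →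
          Thm31GpMaj (g := geo9Y x) (blkSK x.toKIdx (sIK x.toKIdx (bI x))) (blkBK x.toKIdx (bI x))
            (GcoS x.toKIdx b (bg9YR 𝔸 G R₁ R₂ x) (fun U => U) (𝔏 x).Gp U)
            (DvcoKH x.toKIdx b (bg9YR 𝔸 G R₁ R₂ x) (fun U => U) U) (DvscoKH x.toKIdx b (bg9YR 𝔸 G R₁ R₂ x) (fun U => U) U)
            (R x) (H x) (((d + 1 : ℕ) : ℝ) * C) δ := by
  obtain ⟨M₂, a₀, hM₂, ha₀, H37⟩ := t37
  exact ⟨M₂, a₀, hM₂, ha₀, fun x hM α₀ hα₀ hMa U hU =>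
    thm31GpMaj_of_conv342 x b (bg9YR 𝔸 G R₁ R₂ x) (fun U => U) (𝔏 x).Gp (𝔬 x) hC (hconv x U (H37 x hM α₀ hα₀ hMa U hU)) (hbI0 x)
      (hblkS x) (hblkYS x) (hGpS x U) (hDS x U) (hDsS x U)⟩

/-- ★★ **ROWS 18's LEAF ON THE `PairM` E-LETTER ⟹ THE THEOREM-3.1 LETTER SCHEMA OF ROWS 20–21's Δ′_π MAJORANTS, R-GENERIC** (STEP-3 twin of `thm31GpMaj_of_t37_pairM`): from
`t37 : B9.Thm37Printed c35 geo9Y (bg9YR 𝔸 G R₁ R₂) (E37YPairM …)`, direction-blind `bI` and the three site pins, every member in the leaf's regime with `R₁ x c35 α₀ U` has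
`Thm31GpMaj (blkSK (sIK (bI x))) (blkBK (bI x)) (GcoS …) (DvcoKH …) (DvscoKH …) 1 (H x) ((d+1)·p.C (exp261 geo9Y p.δ₀ p.α)) ((1 − 2p.α)p.δ₀)`; at `R₁ := regY335`, `R₂ := regY336`
this is the landed face verbatim (`bg9Y_eq_bg9YR`). [cite: Balaban1985BackgroundPropagators, Thm 3.7 (3.85)–(3.86) p.409 + Thm 3.1 (3.42) p.397 + (3.131) p.422; Balaban1984PropagatorsII, Lemma 2.1 (2.60) p.234] -/
theorem thm31GpMaj_of_t37_pairMR {G : Subgroup 𝔸ˣ} {R₁ R₂ : RegFamY d ℓ hd hL b₀ b₁ Mstar 𝔸} (b : Module.Basis κ ℝ 𝔸) {c35 : ℝ}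
    (𝔏 : ∀ x : MemberY d ℓ hd hL b₀ b₁ Mstar, CovLettersY 𝔸 x) {ι : MemberY d ℓ hd hL b₀ b₁ Mstar → Type}
    (𝔬 : ∀ x : MemberY d ℓ hd hL b₀ b₁ Mstar, Ops (geo9Y x) (bg9YR 𝔸 G R₁ R₂ x) (XSK κ x.toKIdx) (XSK κ x.toKIdx) (ι x))
    (rd : ∀ x : MemberY d ℓ hd hL b₀ b₁ Mstar, WalkReading (geo9Y x) (bg9YR 𝔸 G R₁ R₂ x) (XSK κ x.toKIdx) (ι x))
    (H : MemberY d ℓ hd hL b₀ b₁ Mstar → Prop) {m mN' : ℕ} {Cev NQ : ℝ} {p q : PinPrims} (hp : p.OK) {p3 q3 : PairPrims} {pM qM : MixedPrims}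
    {K : ∀ x : MemberY d ℓ hd hL b₀ b₁ Mstar, B9.KernelFamily (geo9Y x) (bg9YR 𝔸 G R₁ R₂ x)}
    (t37 : B9.Thm37Printed c35 (fun x : MemberY d ℓ hd hL b₀ b₁ Mstar => geo9Y x) (fun x => bg9YR 𝔸 G R₁ R₂ x)
      (fun x => E37YPairM (bg := bg9YR 𝔸 G R₁ R₂) m mN' Cev NQ p q p3 q3 pM qM (𝔬 x) (rd x) (H x) (K x)))
    {bI : ∀ x : MemberY d ℓ hd hL b₀ b₁ Mstar, FBondY x.toKIdx → IBondY x.toKIdx}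
    (hbI0 : ∀ (x : MemberY d ℓ hd hL b₀ b₁ Mstar) (f : FBondY x.toKIdx), bI x f = bI x ⟨f.src, 0⟩)
    (hblkS : ∀ x : MemberY d ℓ hd hL b₀ b₁ Mstar, (𝔬 x).blk = blkSK x.toKIdx (sIK x.toKIdx (bI x)))
    (hblkYS : ∀ x : MemberY d ℓ hd hL b₀ b₁ Mstar, (𝔬 x).blkY = blkSK x.toKIdx (sIK x.toKIdx (bI x)))
    (hGpS : ∀ (x : MemberY d ℓ hd hL b₀ b₁ Mstar) (U : (bg9YR 𝔸 G R₁ R₂ x).Cfg),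
      (𝔬 x).Gp U = GcoS x.toKIdx b (bg9YR 𝔸 G R₁ R₂ x) (fun U => U) (𝔏 x).Gp U)
    (hDS : ∀ (x : MemberY d ℓ hd hL b₀ b₁ Mstar) (U : (bg9YR 𝔸 G R₁ R₂ x).Cfg), (𝔬 x).D U = DcoS x.toKIdx b (bg9YR 𝔸 G R₁ R₂ x) (fun U => U) U)
    (hDsS : ∀ (x : MemberY d ℓ hd hL b₀ b₁ Mstar) (U : (bg9YR 𝔸 G R₁ R₂ x).Cfg), (𝔬 x).Dstar U = DscoS x.toKIdx b (bg9YR 𝔸 G R₁ R₂ x) (fun U => U) U) :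
    ∃ M₂ a₀ : ℝ, 0 < M₂ ∧ 0 < a₀ ∧
      ∀ x : MemberY d ℓ hd hL b₀ b₁ Mstar, M₂ ≤ (geo9Y x).M → ∀ α₀ : ℝ, 0 < α₀ → (geo9Y x).M * α₀ ≤ a₀ →
        ∀ U : (bg9YR 𝔸 G R₁ R₂ x).Cfg, (bg9YR 𝔸 G R₁ R₂ x).Reg335 c35 α₀ U →
          Thm31GpMaj (g := geo9Y x) (blkSK x.toKIdx (sIK x.toKIdx (bI x))) (blkBK x.toKIdx (bI x))
            (GcoS x.toKIdx b (bg9YR 𝔸 G R₁ R₂ x) (fun U => U) (𝔏 x).Gp U)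
            (DvcoKH x.toKIdx b (bg9YR 𝔸 G R₁ R₂ x) (fun U => U) U) (DvscoKH x.toKIdx b (bg9YR 𝔸 G R₁ R₂ x) (fun U => U) U)
            1 (H x) (((d + 1 : ℕ) : ℝ) * p.C (exp261 (@geo9Y d ℓ hd hL b₀ b₁ Mstar) p.δ₀ p.α)) ((1 - 2 * p.α) * p.δ₀) :=
  thm31GpMaj_of_thm37PrintedR (R := fun _ => (1 : ℝ)) b 𝔏 𝔬 _ t37 (p.C_nonneg hp _) (fun _ _ h => h.1) hbI0 hblkS hblkYS hGpS hDS hDsS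

end Family

end Literature.MathematicalPhysics.QuantumFieldTheory.Balaban1983to89.B9Thm31GpMajFromPinsPairMR
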